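import Literature.NumberTheory.LFunctions.ZetaSpacingDensitySelbergMinorant
import Literature.NumberTheory.LFunctions.PairCorrelationSDPBounds
import HarnessLib

/-!
# Bui–Goldston–Milinovich–Montgomery 2023, Corollary 2 (second half): on RH and `n* ≤ 1.3208`, `μ_{D_d} ≤ 1.0522`

Topic `Literature/NumberTheory/LFunctions` (namespace `Literature.NumberTheory.LFunctions.BGMM2023`). PROOF LAYER
(cell `landau-siegel`, §C literature harvest, seat ls-lit-typer-2 g4; OFFER-B Part (iii), ls-lit-lead g3 WORDS #9
2026-08-27): THEOREMS ONLY — no definitions, no named facts, no new hypotheses. Source: H. M. Bui, D. A. Goldston,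
M. B. Milinovich, H. L. Montgomery, *Small gaps and small spacings between zeta zeros*, Acta Arith. 210 (2023)
133–153 (arXiv:2208.02359), Theorem 3 (second clause) and §4, end of the proof of Corollary 2 (arXiv p. 8):

> "To find distinct gaps, we need `c(λ;r) > n* − 1`. Using the best known bound `n* ≤ 1.3208` from [CGdL], we
> find that `c(1.05214;r) > 0.3208`, which establishes the bound `μ_{D_d} ≤ 1.05214`."

with `n* = lim sup_T N(T)⁻¹ Σ_{0<γ_d≤T} m(γ_d)²` (the sum of the squared multiplicities of the DISTINCT
ordinates). Inputs, all tree theorems: Theorem 3, second clause (`BGMM2023.gapDensityPos_of_RH`,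
`ZetaSpacingDensityRHProofs.lean`: RH, `r ∈ 𝒜(λ)`, and `Σ m(γ_d)² ≤ νN(T)` for large `T` with `ν < c(λ;r) + 1`
give `lim inf_T D_d(λ,T) > 0`); the Selberg minorant `r = R(·/1.0522) ∈ 𝒜(1.0522)` with `c(1.0522;r) > 0.32084`
(`BGMM2023.isAdmissible_selbergMinorant_div`, `cValue_selbergMinorant_1_0522_gt`, `ZetaSpacingDensitySelbergMinorant.lean`);
and the ordinate dictionary of `ZetaZeroBoxEnumeration.lean`. The bound `n* ≤ 1.3208` itself (Chirre–Gonçalves–de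
Laat 2020, Theorem 1, by semidefinite programming) is NOT proved in the tree: it enters BY NAME as the hypothesis
`CGdL2020.NStarLe 1.3208` (`PairCorrelationSDPBounds.lean`; `chirreGoncalvesDeLaat2020_theorem1` is the typed fact
`(RiemannHypothesis → NStarLe 1.3208) ∧ (GRH → NStarLe 1.3155)`).

## What is proved

* `BGMM2023.multPairCount_eq_coincidentPairCount` — the tree's two spellings of `Σ_{γ_d ≤ T} m(γ_d)²` as ordered
  pairs of indices `n, n′ < N(T)` with `γ_n = γ_{n′}` agree (`BGMM2023.multPairCount = GLSS2026.coincidentPairCount`,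
  by `rfl`).
* **`BGMM2023.multPairCount_eq_nStar_of_RH`** — on RH, `Σ_{γ_d ≤ T} m(γ_d)² = N*(T)` (`CGdL2020.nStar T =
  Σ_{ρ distinct, 0<γ≤T} m_ρ²`): the ordinate fibre of the enumeration over `Im ρ` has `Σ_{ρ′ : Im ρ′ = Im ρ} m_{ρ′}`
  elements (`Montgomery.card_filter_zetaOrdinate_eq`), and under RH that fibre of the box is `{ρ}` (all zeros of a
  box lie on `Re s = ½`, `re_eq_one_half_of_mem_zetaZeroBox`). (Without RH one only has `N⊛ ≥ N*`, cf.
  `GLSS2026.two_mul_zetaZeroCount_sub_coincidentPairCount_le`.)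
* `BGMM2023.exists_multPairCount_le_of_nStarLe` — on RH, `NStarLe c` gives `Σ m(γ_d)² ≤ (c + ε)N(T)` for all
  large `T` (the hypothesis shape of Theorem 3's second clause).
* **`BGMM2023.gapDensityPos_1_0522_of_RH_of_nStarLe : RiemannHypothesis → CGdL2020.NStarLe 1.3208 →
  BGMM2023.GapDensityPos 1.0522`** — for some `A > 0` and all large `T`, at least `A·N(T)` indices `n < N(T)` have
  `γ_n < γ_{n+1} ≤ γ_n + 2π·1.0522/log T` (genuine gaps between DISTINCT consecutive zeros), with
  `ν = 1.3208 + 4·10⁻⁶ < c(1.0522;r) + 1`.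
* `BGMM2023.gapDensityPos_one_of_RH_of_nStarLe` — the printed Remark as a theorem: on RH, any `n*`-bound
  `ν < 4/3 − 1/2π² = 1.282673…` (`NStarLe ν`) gives `lim inf_T D_d(1,T) > 0` (Selberg minorant at `λ = 1`,
  `c(1;r) = 1/3 − 1/2π²`).
* **`BGMM2023.muDdLe_1_0522_of_RH : chirreGoncalvesDeLaat2020_theorem1 → RiemannHypothesis → BGMM2023.MuDdLe 1.0522`**
  and `buiEtAl2023_corollary2_of_theorem1 : buiEtAl2023_theorem1 → chirreGoncalvesDeLaat2020_theorem1 →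
  buiEtAl2023_corollary2` (the typed Corollary 2 reduces to the typed Theorem 1 plus CGdL's Theorem 1: its
  `μ_{D_d}` half is kernel modulo CGdL).

Rendering notes. Print has `1.05214`; the typed Corollary 2 (`buiEtAl2023_corollary2`) and this file use the
printed rounded `1.0522` (`c(1.0522;r) = 0.0522 + (1/3 − 1/2π²)/1.0522 = 0.320849… > 0.32084 ≥ n* − 1 + 4·10⁻⁶`).
No knife edge of the Landau–Siegel programme moves (`1.0522 > ½`; RH and `n* ≤ 1.3208` are displayed hypotheses,
never asserted). LABEL: **NOT RH-BEARING**. «The programme SEARCHES and TYPES; no claim about Landau–Siegel zeros,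
Theorems 1–2 of arXiv:2211.02515 or a repaired Margin232 until a kernel theorem says so.»

## References

* [BuiEtAl2023] H. M. Bui, D. A. Goldston, M. B. Milinovich, H. L. Montgomery, Acta Arith. 210 (2023) 133–153,
  arXiv:2208.02359: §1 (`μ_{D_d}`), §2 (`n*`, Theorem 3), Corollary 2, §4 (end of the proof of Corollary 2).
* [ChirreGoncalvesDelaat2020] A. Chirre, F. Gonçalves, D. de Laat, Adv. Math. 361 (2020) 106926, Theorem 1
  (`N*(T) ≤ (1.3208 + o(1))N(T)` on RH) — tree: `PairCorrelationSDPBounds.lean` (typed fact, not proved).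
* Tree: `ZetaSpacingDensityRH.lean`, `ZetaSpacingDensityRHProofs.lean`, `ZetaSpacingDensitySelbergMinorant.lean`,
  `ZetaZeroBoxEnumeration.lean` (ordinate dictionary), `AlternativeHypothesisConsequences.lean`
  (`GLSS2026.coincidentPairCount`), `SimpleZeros.lean` (`re_eq_one_half_of_mem_zetaZeroBox`).
-/


noncomputable section

open Filter Set MeasureTheory Real Finset

namespace Literature.NumberTheory.LFunctions

namespace BGMM2023

/-- `Σ_{γ_d ≤ T} m(γ_d)²` in the index vocabulary is GLSS's `N⊛(T)`. [cite: BuiEtAl2023, §2 (before Theorem 3)] -/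
theorem multPairCount_eq_coincidentPairCount (T : ℝ) :
    multPairCount T = GLSS2026.coincidentPairCount T := rfl

/-- **On RH, `Σ_{γ_d ≤ T} m(γ_d)² = N*(T)`** (`N*(T) = Σ_{ρ distinct} m_ρ²`, Chirre–Gonçalves–de Laat): under RH
two zeros of the box with the same ordinate coincide, so the ordinate-fibres of the enumeration are the
multiplicities. [cite: BuiEtAl2023, §2 (definition of n* before Theorem 3)] -/
theorem multPairCount_eq_nStar_of_RH (hRH : RiemannHypothesis) (T : ℝ) :
    (multPairCount T : ℤ) = CGdL2020.nStar T := by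
  classical
  set B : Finset ℂ := (zetaZeroBox_finite 0 T).toFinset with hB
  set R : Finset ℕ := Finset.range (zetaZeroCount T) with hR
  have hmemB : ∀ ρ, ρ ∈ B ↔ ρ ∈ zetaZeroBox 0 T := fun ρ ↦ Set.Finite.mem_toFinset _
  -- `c(v) = #{n < N(T) : γ_n = v} = Σ_{ρ ∈ B, Im ρ = v} m(ρ)` (ordinate dictionary)
  have hcv : ∀ v : ℝ, (((R.filter fun n ↦ zetaOrdinate n = v).card : ℕ) : ℤ) =
      ∑ ρ ∈ B.filter (fun ρ ↦ ρ.im = v), riemannZetaZeroOrder ρ := by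
    intro v
    rw [hR, Montgomery.card_filter_zetaOrdinate_eq T v]
    have hfin : {ρ | ρ ∈ zetaZeroBox 0 T ∧ ρ.im = v}.Finite :=
      (zetaZeroBox_finite 0 T).subset fun ρ h ↦ h.1
    rw [finsum_mem_eq_finite_toFinset_sum _ hfin]
    refine Finset.sum_congr ?_ fun _ _ ↦ rfl
    ext ρ
    simp [hB]
  -- under RH the fibre of `B` over `Im ρ` is `{ρ}`
  have hfib : ∀ ρ ∈ B, B.filter (fun ρ' ↦ ρ'.im = ρ.im) = {ρ} := by
    intro ρ hρ
    ext ρ'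
    simp only [Finset.mem_filter, Finset.mem_singleton]
    constructor
    · rintro ⟨hρ', him⟩
      apply Complex.ext
      · rw [re_eq_one_half_of_mem_zetaZeroBox hRH ((hmemB ρ').1 hρ'),
          re_eq_one_half_of_mem_zetaZeroBox hRH ((hmemB ρ).1 hρ)]
      · exact him
    · rintro rfl
      exact ⟨hρ, rfl⟩
  -- `Σ m(γ_d)² = Σ_{i < N(T)} c(γ_i)`
  have hD : (multPairCount T : ℤ) =
      ∑ i ∈ R, (((R.filter fun n ↦ zetaOrdinate n = zetaOrdinate i).card : ℕ) : ℤ) := by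
    unfold multPairCount
    rw [Finset.card_filter, Finset.sum_product]
    push_cast
    refine Finset.sum_congr rfl fun i _ ↦ ?_
    rw [Finset.card_filter]
    push_cast
    exact Finset.sum_congr rfl fun j _ ↦ if_congr eq_comm rfl rfl
  -- dictionary: `Σ_{i < N(T)} f(γ_i) = Σ_{ρ ∈ B} m(ρ) f(Im ρ)`
  have hdict : ∀ f : ℝ → ℤ,
      ∑ i ∈ R, f (zetaOrdinate i) = ∑ ρ ∈ B, riemannZetaZeroOrder ρ * f ρ.im := by
    intro f
    have h := Montgomery.finsum_zetaZeroBox_mul_eq_sum_range (fun v ↦ ((f v : ℤ) : ℂ)) T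
    rw [finsum_mem_eq_finite_toFinset_sum _ (zetaZeroBox_finite 0 T)] at h
    exact_mod_cast h.symm
  rw [hD, hdict fun v ↦ (((R.filter fun n ↦ zetaOrdinate n = v).card : ℕ) : ℤ)]
  obtain ⟨-, hS, -, -⟩ := CGdL2020.counts_eq T
  rw [hS]
  refine Finset.sum_congr rfl fun ρ hρ ↦ ?_
  rw [hcv, hfib ρ hρ, Finset.sum_singleton, sq]

/-- From `N*(T) ≤ (c + o(1))N(T)` to the hypothesis of Theorem 3's second clause, on RH.
[cite: BuiEtAl2023, Theorem 3 ("c(λ*;r) > n* − 1")] -/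
theorem exists_multPairCount_le_of_nStarLe (hRH : RiemannHypothesis) {c ε : ℝ} (hε : 0 < ε)
    (h : CGdL2020.NStarLe c) :
    ∃ T₀ : ℝ, ∀ T : ℝ, T₀ ≤ T → (multPairCount T : ℝ) ≤ (c + ε) * zetaZeroCount T := by
  obtain ⟨T₀, hT₀⟩ := Filter.eventually_atTop.mp (h ε hε)
  refine ⟨T₀, fun T hT ↦ ?_⟩
  have h2 : ((multPairCount T : ℤ) : ℝ) = (CGdL2020.nStar T : ℝ) := by
    exact_mod_cast multPairCount_eq_nStar_of_RH hRH T
  have h3 : (multPairCount T : ℝ) = ((multPairCount T : ℤ) : ℝ) := by norm_cast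
  rw [h3, h2]
  exact hT₀ T hT

/-- **RH and `n* ≤ 1.3208` ⇒ `lim inf_T D_d(1.0522, T) > 0`** (Theorem 3, second clause, with the Selberg
minorant: `c(1.0522;r) > 0.32084 ≥ (1.3208 + 4·10⁻⁶) − 1`). [cite: BuiEtAl2023, §4 (proof of Corollary 2, "μ_{D_d} ≤ 1.05214")] -/
theorem gapDensityPos_1_0522_of_RH_of_nStarLe (hRH : RiemannHypothesis) (hN : CGdL2020.NStarLe 1.3208) :
    GapDensityPos 1.0522 := by
  obtain ⟨T₀, hT₀⟩ := exists_multPairCount_le_of_nStarLe hRH (ε := 0.000004) (by norm_num) hN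
  refine gapDensityPos_of_RH hRH (by norm_num) (isAdmissible_selbergMinorant_div (by norm_num))
    (ν₀ := 1.3208 + 0.000004) ?_ hT₀
  have := cValue_selbergMinorant_1_0522_gt
  linarith

/-- **RH and CGdL's Theorem 1 ⇒ `μ_{D_d} ≤ 1.0522`** (Corollary 2, second half, modulo the typed fact
`chirreGoncalvesDeLaat2020_theorem1`). [cite: BuiEtAl2023, Corollary 2] -/
theorem muDdLe_1_0522_of_RH (hC : chirreGoncalvesDeLaat2020_theorem1) (hRH : RiemannHypothesis) :
    MuDdLe 1.0522 :=
  fun _ hlam ↦ (gapDensityPos_1_0522_of_RH_of_nStarLe hRH (hC.1 hRH)).mono hlam.le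

/-- **The printed Remark as a theorem: on RH, `n* < 4/3 − 1/2π² (= 1.282673…)` would give `μ_{D_d} ≤ 1`**
("since `c(1;r) = 1/3 − 1/2π²`, in order to prove `μ_{D_d} < 1` we would need a bound of `n* ≤ 1.2826`"):
Theorem 3, second clause, with the Selberg minorant at `λ = 1`. [cite: BuiEtAl2023, §4 (Remark after the proof of Corollary 2)] -/
theorem gapDensityPos_one_of_RH_of_nStarLe (hRH : RiemannHypothesis) {ν : ℝ}
    (hν : ν < 4 / 3 - 1 / (2 * π ^ 2)) (hN : CGdL2020.NStarLe ν) : GapDensityPos 1 := by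
  obtain ⟨T₀, hT₀⟩ := exists_multPairCount_le_of_nStarLe hRH (ε := (4 / 3 - 1 / (2 * π ^ 2) - ν) / 2)
    (by linarith) hN
  refine gapDensityPos_of_RH hRH one_pos (isAdmissible_selbergMinorant_div one_pos)
    (ν₀ := ν + (4 / 3 - 1 / (2 * π ^ 2) - ν) / 2) ?_ hT₀
  rw [cValue_selbergMinorant_one]
  linarith

end BGMM2023

/-- **Corollary 2 from Theorem 1 and Chirre–Gonçalves–de Laat's Theorem 1** (bookkeeping between the typed
facts: the `μ_{D_d}` half is now kernel modulo CGdL). [cite: BuiEtAl2023, Corollary 2] -/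
theorem buiEtAl2023_corollary2_of_theorem1 (h1 : buiEtAl2023_theorem1)
    (hC : chirreGoncalvesDeLaat2020_theorem1) : buiEtAl2023_corollary2 :=
  fun hRH ↦ ⟨h1 hRH, BGMM2023.muDdLe_1_0522_of_RH hC hRH⟩

end Literature.NumberTheory.LFunctions

end
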